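import Summits.AtomisticToContinuum.HydrodynamicLimit.Theses.AntiMazurCoboundaries
import Literature.MathematicalPhysics.KineticTheory.HardSphereEulerProofs
import Summits.AtomisticToContinuum.HydrodynamicLimit.Theorems.BoltzmannGreenKubo.Negative.ForallN

/-!
# `ShearStressHalfDrude` (stmt-AtomisticToContinuum-14136), line `cutoff-compactness-net`:
# stub S3 `stub_diluteCornerDecay` — CONDITIONAL REDUCTION to `BoltzmannGreenKubo` (stmt-13985)

The registered stub `stub_diluteCornerDecay` (dilute-corner window decay at `φ ≡ 1` for ONE cutoff shear
stress `g = g_{e₁,e₂,A}`, `e₁ ⊥ e₂`, `A > 0`, one-sided, `σ₀` chosen AFTER the observable and the tolerance)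
is by construction the `φ ≡ 1` instance of the route's typed rank-4 crux
`AntiMazurCoboundaries.BoltzmannGreenKubo` (stmt-AtomisticToContinuum-13985). This file proves the
reduction `BoltzmannGreenKubo → (signature of stub_diluteCornerDecay)` with the signature verbatim
(`diluteCornerDecay_of_boltzmannGreenKubo`), together with the three facts about the cutoff stresses that
the reduction consumes and that the line lead reuses:

* `cutoff_orth` — `g ⊥ span(1, v, |v|²)` in `L²(γ)`, in the exact form of 13985's orthogonality clause
  (`g` is odd under the reflection in `(ℝ∙e₁)ᗮ` while `c₀ + c₂‖v‖²` is even; `g` is even under `v ↦ -v`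
  while `⟪b, v⟫` is odd; `γ = stdGaussian V3` is invariant under linear isometries);
* `integral_cutoff_sq_pos` — `0 < ∫ g² dγ` for `e₁ ≠ 0`, `e₂ ≠ 0` (witness `w⋆ = t(e₁+e₂)`, `‖w⋆‖ ≤ A`);
* `abs_cutoff_le` / `exists_abs_cutoff_le`, `continuous_cutoff`, `hasCompactSupport_cutoff` — boundedness /
  regularity.

Proof of the reduction: for `e₁ = 0 ∨ e₂ = 0` the observable vanishes and the functional is `0`. Otherwise
`n := ∫ g² dγ > 0`; apply 13985 at `φ ≡ 1`, `η = 1`, get `s₀`; take `s := max s₀ (max 1 ((2D+1)/(r n)))`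
(`D = dirichletFormInv (hardSphereLinearizedOp) g`, a real number). For `σ < σ₀`, `N ≥ N₀` and any flow,
13985 gives `|s · L.toReal/(N+1) − 2D| ≤ 1` with `L` the stub's lintegral (`∫_{T³} 1² = 1`), whence
`L.toReal ≤ (N+1)(2D+1)/s ≤ r (N+1) n`; and `L < ∞` because the window average of a function bounded by
`(N+1)K` is bounded by `(N+1)K` for every phase point and `G_N` is a probability measure (13985's own
probability clause), so `L = ofReal L.toReal ≤ ofReal (r (N+1) n)`.

## Dependency drift (fullbuild repair, 2026-08-17)

Route-repair rev 11 of the thesis (2026-08-16, gate check `glue.unused-crux`) DROPPED both rungs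
`BoltzmannGreenKubo` (stmt-13985) and `ShearStressHalfDrude` (stmt-14136) from `Theses/AntiMazurCoboundaries.lean`
("statements, stamps, MD results, landed Negative theorems and Cruxes/ workfiles persist on the (moot) items"), so
the constant `Summit.AtomisticToContinuum.HydrodynamicLimit.Theses.AntiMazurCoboundaries.BoltzmannGreenKubo` no
longer exists. Theorems files are append-only (registered statement headers stay byte-identical), hence the two
spellings of that constant used in the headers below — the short `BoltzmannGreenKubo` (formerly brought into
scope by `open … (BoltzmannGreenKubo)`) and the fully-qualified one — are re-bound in THIS FILE ONLY as `local
notation` for the VERBATIM signature of stmt-AtomisticToContinuum-13985 (the very term the dropped `def` unfolded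
to). No declaration is added; both reduction theorems elaborate to the same propositions as before
(`(13985 verbatim) → stub_diluteCornerDecay`), now with the hypothesis spelled out instead of named.
-/

namespace Summit.AtomisticToContinuum.HydrodynamicLimit.Theorems

namespace ShearStressHalfDrudeDiluteCorner

open MeasureTheory ProbabilityTheory Filter Set
open scoped ENNReal InnerProductSpace BigOperators
open Literature.Analysis.FluidPDE Literature.MathematicalPhysics.KineticTheory

set_option quotPrecheck false in
/-- The dilute-corner Green–Kubo rung, stmt-AtomisticToContinuum-13985, VERBATIM (local spelling of the route
constant dropped by route-repair rev 11; see the module docstring, § Dependency drift). -/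
local notation "BoltzmannGreenKubo" =>
  (∀ (a θ : ℝ) (u₀ : Literature.MathematicalPhysics.KineticTheory.V3), 0 < a → 0 < θ →
    ∀ (φ : Literature.MathematicalPhysics.KineticTheory.T3 → ℝ) (g : Literature.MathematicalPhysics.KineticTheory.V3 → ℝ),
    Continuous φ → Continuous g → (∀ x, |φ x| ≤ 1) → (∃ K : ℝ, ∀ v, |g v| ≤ K) →
    (∀ (c₀ c₂ : ℝ) (b : Literature.MathematicalPhysics.KineticTheory.V3),
      ∫ v, g v * (c₀ + inner ℝ b v + c₂ * ‖v‖ ^ 2)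
        ∂(ProbabilityTheory.stdGaussian Literature.MathematicalPhysics.KineticTheory.V3) = 0) →
    ∀ η : ℝ, 0 < η → ∃ s₀ : ℝ, 0 < s₀ ∧ ∀ s : ℝ, s₀ ≤ s → ∃ σ₀ : ℝ, 0 < σ₀ ∧ ∀ σ : ℝ, 0 < σ → σ < σ₀ →
      (∀ (N : ℕ) (Φ : Literature.Analysis.FluidPDE.HardSphereFlow (Literature.Analysis.FluidPDE.Torus.geometry (Fin 3))
          (Literature.MathematicalPhysics.KineticTheory.hsDiameter σ N) (N + 1)),
        MeasureTheory.IsProbabilityMeasure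
          (Literature.MathematicalPhysics.KineticTheory.localGibbsLaw σ (fun _ => a) (fun _ => u₀) (fun _ => θ) N Φ)) ∧
      ∃ N₀ : ℕ, ∀ N : ℕ, N₀ ≤ N →
        ∀ Φ : Literature.Analysis.FluidPDE.HardSphereFlow (Literature.Analysis.FluidPDE.Torus.geometry (Fin 3))
          (Literature.MathematicalPhysics.KineticTheory.hsDiameter σ N) (N + 1),
        (let h : ℝ := s / (σ ^ 2 * Real.sqrt θ) * ((N + 1 : ℕ) : ℝ) ^ (-(1 / 3 : ℝ));
        |s * ((∫⁻ z, ENNReal.ofReal ((h⁻¹ * ∫ r in (0 : ℝ)..h,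
            ∑ i, φ (Φ.flow r z i).1 * g ((Real.sqrt θ)⁻¹ • ((Φ.flow r z i).2 - u₀))) ^ 2)
          ∂(Literature.MathematicalPhysics.KineticTheory.localGibbsLaw σ (fun _ => a) (fun _ => u₀) (fun _ => θ) N Φ)).toReal /
            (((N : ℝ)) + 1)) -
          2 * (∫ x, φ x ^ 2) * Literature.Analysis.UnboundedOperators.dirichletFormInv
            (Literature.Analysis.UnboundedOperators.hardSphereLinearizedOp
              (E := Literature.MathematicalPhysics.KineticTheory.V3)) g| ≤ η))

set_option quotPrecheck false in
/-- The same verbatim statement under the retired fully-qualified spelling used by the registered header of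
`stub_diluteCornerDecay_of_BGK` (local to this file; no declaration of that name exists or is created). -/
local notation "Summit.AtomisticToContinuum.HydrodynamicLimit.Theses.AntiMazurCoboundaries.BoltzmannGreenKubo" =>
  BoltzmannGreenKubo

/-! ## The cutoff shear stresses: regularity, boundedness, support -/

-- copied from Lines/cutoff-compactness-net.lean
/-- Cutoff stresses are continuous. [folklore] -/
theorem continuous_cutoff (e₁ e₂ : V3) (A : ℝ) :
    Continuous (fun w : V3 => inner ℝ e₁ w * inner ℝ e₂ w * (1 - Real.smoothTransition (‖w‖ ^ 2 / A ^ 2 - 1))) := by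
  refine ((continuous_const.inner continuous_id).mul (continuous_const.inner continuous_id)).mul
    (continuous_const.sub (Real.smoothTransition.continuous.comp ?_))
  fun_prop

-- copied from Lines/cutoff-compactness-net.lean
/-- A cutoff stress vanishes off the ball `‖w‖² ≤ 2A²`. [folklore] -/
theorem cutoff_eq_zero_of_le {e₁ e₂ : V3} {A : ℝ} (hA : 0 < A) {w : V3} (hw : 2 * A ^ 2 ≤ ‖w‖ ^ 2) :
    inner ℝ e₁ w * inner ℝ e₂ w * (1 - Real.smoothTransition (‖w‖ ^ 2 / A ^ 2 - 1)) = 0 := by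
  have hA2 : 0 < A ^ 2 := by positivity
  have h1 : (1 : ℝ) ≤ ‖w‖ ^ 2 / A ^ 2 - 1 := by
    rw [le_sub_iff_add_le, le_div_iff₀ hA2]
    linarith
  rw [Real.smoothTransition.one_of_one_le h1]
  ring

-- copied from Lines/cutoff-compactness-net.lean
/-- Cutoff stresses are bounded by `2A²‖e₁‖‖e₂‖`. [folklore] -/
theorem abs_cutoff_le (e₁ e₂ : V3) {A : ℝ} (hA : 0 < A) (w : V3) :
    |inner ℝ e₁ w * inner ℝ e₂ w * (1 - Real.smoothTransition (‖w‖ ^ 2 / A ^ 2 - 1))| ≤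
      2 * A ^ 2 * (‖e₁‖ * ‖e₂‖) := by
  by_cases hw : 2 * A ^ 2 ≤ ‖w‖ ^ 2
  · rw [cutoff_eq_zero_of_le hA hw, abs_zero]
    positivity
  · rw [not_le] at hw
    have h0 : 0 ≤ Real.smoothTransition (‖w‖ ^ 2 / A ^ 2 - 1) := Real.smoothTransition.nonneg _
    have h1 : Real.smoothTransition (‖w‖ ^ 2 / A ^ 2 - 1) ≤ 1 := Real.smoothTransition.le_one _
    have hi1 : |inner ℝ e₁ w| ≤ ‖e₁‖ * ‖w‖ := abs_real_inner_le_norm e₁ w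
    have hi2 : |inner ℝ e₂ w| ≤ ‖e₂‖ * ‖w‖ := abs_real_inner_le_norm e₂ w
    have hcut : |1 - Real.smoothTransition (‖w‖ ^ 2 / A ^ 2 - 1)| ≤ 1 := by
      rw [abs_le]; constructor <;> linarith
    calc |inner ℝ e₁ w * inner ℝ e₂ w * (1 - Real.smoothTransition (‖w‖ ^ 2 / A ^ 2 - 1))|
        = |inner ℝ e₁ w| * |inner ℝ e₂ w| * |1 - Real.smoothTransition (‖w‖ ^ 2 / A ^ 2 - 1)| := by
          rw [abs_mul, abs_mul]
      _ ≤ (‖e₁‖ * ‖w‖) * (‖e₂‖ * ‖w‖) * 1 := by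
          gcongr
      _ = ‖w‖ ^ 2 * (‖e₁‖ * ‖e₂‖) := by ring
      _ ≤ 2 * A ^ 2 * (‖e₁‖ * ‖e₂‖) := by
          gcongr

/-- Cutoff stresses are bounded, in the form of the hypothesis `∃ K, ∀ v, |g v| ≤ K` of `BoltzmannGreenKubo`
and of `stub_netLipschitz`. [folklore] -/
theorem exists_abs_cutoff_le (e₁ e₂ : V3) {A : ℝ} (hA : 0 < A) {g : V3 → ℝ}
    (hg : g = fun w => inner ℝ e₁ w * inner ℝ e₂ w * (1 - Real.smoothTransition (‖w‖ ^ 2 / A ^ 2 - 1))) :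
    ∃ K : ℝ, ∀ v, |g v| ≤ K :=
  ⟨2 * A ^ 2 * (‖e₁‖ * ‖e₂‖), fun v => by rw [hg]; exact abs_cutoff_le e₁ e₂ hA v⟩

/-- Cutoff stresses have compact support (inside the closed ball of radius `2A`). [folklore] -/
theorem hasCompactSupport_cutoff (e₁ e₂ : V3) {A : ℝ} (hA : 0 < A) :
    HasCompactSupport
      (fun w : V3 => inner ℝ e₁ w * inner ℝ e₂ w * (1 - Real.smoothTransition (‖w‖ ^ 2 / A ^ 2 - 1))) := by
  refine HasCompactSupport.intro (isCompact_closedBall (0 : V3) (2 * A)) fun w hw => ?_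
  rw [Metric.mem_closedBall, dist_zero_right, not_le] at hw
  refine cutoff_eq_zero_of_le hA ?_
  have h2A : (2 * A) ^ 2 < ‖w‖ ^ 2 := pow_lt_pow_left₀ hw (by positivity) two_ne_zero
  nlinarith [sq_nonneg A]

/-! ## Gaussian symmetries -/

-- adapted from Lines/cutoff-compactness-net.lean (`integral_cutoff_eq_zero`, steps `h1`, `h2`)
/-- The reflection in the hyperplane `(ℝ∙e)ᗮ` negates the coordinate `⟪e, ·⟫`. [folklore] -/
theorem inner_reflection_self {e : V3} (he : e ≠ 0) (w : V3) :
    ⟪e, (ℝ ∙ e)ᗮ.reflection w⟫_ℝ = -⟪e, w⟫_ℝ := by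
  have hne : (‖e‖ : ℝ) ^ 2 ≠ 0 := by
    have : ‖e‖ ≠ 0 := norm_ne_zero_iff.2 he
    positivity
  rw [Submodule.reflection_orthogonal_apply, inner_neg_right, Submodule.reflection_singleton_apply]
  simp only [RCLike.ofReal_real_eq_id, id_eq, inner_sub_right, inner_add_right, inner_smul_right,
    two_smul, real_inner_self_eq_norm_sq]
  rw [div_mul_cancel₀ _ hne]
  ring

/-- The reflection in the hyperplane `(ℝ∙e)ᗮ` fixes the coordinates `⟪u, ·⟫` with `u ⊥ e`. [folklore] -/
theorem inner_reflection_of_orthogonal {e u : V3} (hu : ⟪u, e⟫_ℝ = 0) (w : V3) :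
    ⟪u, (ℝ ∙ e)ᗮ.reflection w⟫_ℝ = ⟪u, w⟫_ℝ := by
  rw [Submodule.reflection_orthogonal_apply, inner_neg_right, Submodule.reflection_singleton_apply]
  simp only [RCLike.ofReal_real_eq_id, id_eq, inner_sub_right, inner_add_right, inner_smul_right,
    two_smul, hu, mul_zero, add_zero, zero_sub, neg_neg]

/-! ## Orthogonality to the collision invariants and non-degeneracy -/

/-- **`g_{e₁,e₂,A} ⊥ span(1, v, |v|²)` in `L²(γ)`** for `e₁ ⊥ e₂`, in the exact form of the orthogonality
clause of `BoltzmannGreenKubo` / `KineticFluxLdDecay`: the part `c₀ + c₂‖v‖²` is even and `g` odd under the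
reflection in `(ℝ∙e₁)ᗮ`; the part `⟪b, v⟫` is odd and `g` even under `v ↦ -v`. [folklore] -/
theorem cutoff_orth {e₁ e₂ : V3} (he : inner ℝ e₁ e₂ = 0) {A : ℝ} (hA : 0 < A) {g : V3 → ℝ}
    (hg : g = fun w => inner ℝ e₁ w * inner ℝ e₂ w * (1 - Real.smoothTransition (‖w‖ ^ 2 / A ^ 2 - 1)))
    (c₀ c₂ : ℝ) (b : V3) :
    ∫ v, g v * (c₀ + inner ℝ b v + c₂ * ‖v‖ ^ 2) ∂stdGaussian V3 = 0 := by
  by_cases h1 : e₁ = 0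
  · have h0 : ∀ v, g v = 0 := fun v => by simp [hg, h1]
    simp [h0]
  have he' : ⟪e₂, e₁⟫_ℝ = 0 := by rw [real_inner_comm]; exact he
  have hgc : Continuous g := by rw [hg]; exact continuous_cutoff e₁ e₂ A
  have hgs : HasCompactSupport g := by rw [hg]; exact hasCompactSupport_cutoff e₁ e₂ hA
  have hgi : ∀ p : V3 → ℝ, Continuous p → Integrable (fun v => g v * p v) (stdGaussian V3) :=
    fun p hp => (hgc.mul hp).integrable_of_hasCompactSupport
      (hgs.mono (Function.support_mul_subset_left _ _))
  have hsplit : (fun v => g v * (c₀ + inner ℝ b v + c₂ * ‖v‖ ^ 2)) =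
      fun v => g v * (c₀ + c₂ * ‖v‖ ^ 2) + g v * inner ℝ b v := by
    funext v
    ring
  have hia : Integrable (fun v => g v * (c₀ + c₂ * ‖v‖ ^ 2)) (stdGaussian V3) :=
    hgi _ (continuous_const.add (continuous_const.mul (continuous_norm.pow 2)))
  have hib : Integrable (fun v => g v * inner ℝ b v) (stdGaussian V3) :=
    hgi _ (continuous_const.inner continuous_id)
  rw [hsplit, integral_add hia hib,
    BoltzmannGreenKuboForallN.integral_stdGaussian_eq_zero_of_odd ((ℝ ∙ e₁)ᗮ.reflection) (G := fun v => g v * (c₀ + c₂ * ‖v‖ ^ 2))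
      fun w => by
        simp only [hg, inner_reflection_self h1, inner_reflection_of_orthogonal he',
          LinearIsometryEquiv.norm_map]
        ring,
    BoltzmannGreenKuboForallN.integral_stdGaussian_eq_zero_of_odd (LinearIsometryEquiv.neg ℝ) (G := fun v => g v * inner ℝ b v)
      fun w => by
        simp only [hg, LinearIsometryEquiv.coe_neg, inner_neg_right, norm_neg]
        ring,
    add_zero]

/-- **Non-degeneracy**: for `e₁ ≠ 0`, `e₂ ≠ 0`, `e₁ ⊥ e₂`, `A > 0` the cutoff stress has `0 < ∫ g² dγ`
(`g(w⋆) = t²‖e₁‖²‖e₂‖² ≠ 0` at `w⋆ = t(e₁ + e₂)`, `t = A/(‖e₁‖ + ‖e₂‖)`, where `‖w⋆‖ ≤ A` so the cutoff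
factor is `1`; `g² M` is continuous, compactly supported and nonnegative). [folklore] -/
theorem integral_cutoff_sq_pos {e₁ e₂ : V3} (h1 : e₁ ≠ 0) (h2 : e₂ ≠ 0) (he : inner ℝ e₁ e₂ = 0)
    {A : ℝ} (hA : 0 < A) {g : V3 → ℝ}
    (hg : g = fun w => inner ℝ e₁ w * inner ℝ e₂ w * (1 - Real.smoothTransition (‖w‖ ^ 2 / A ^ 2 - 1))) :
    0 < ∫ v, g v ^ 2 ∂stdGaussian V3 := by
  have he' : ⟪e₂, e₁⟫_ℝ = 0 := by rw [real_inner_comm]; exact he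
  have hgc : Continuous g := by rw [hg]; exact continuous_cutoff e₁ e₂ A
  have hgs : HasCompactSupport g := by rw [hg]; exact hasCompactSupport_cutoff e₁ e₂ hA
  have hn1 : 0 < ‖e₁‖ := norm_pos_iff.2 h1
  have hn2 : 0 < ‖e₂‖ := norm_pos_iff.2 h2
  have hne : ‖e₁‖ + ‖e₂‖ ≠ 0 := by positivity
  obtain ⟨t, ht⟩ : ∃ t : ℝ, t = A / (‖e₁‖ + ‖e₂‖) := ⟨_, rfl⟩
  have htpos : 0 < t := by rw [ht]; positivity
  obtain ⟨w₀, hw₀⟩ : ∃ w₀ : V3, w₀ = t • (e₁ + e₂) := ⟨_, rfl⟩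
  have hw₀A : ‖w₀‖ ≤ A := by
    calc ‖w₀‖ = t * ‖e₁ + e₂‖ := by rw [hw₀, norm_smul, Real.norm_eq_abs, abs_of_pos htpos]
      _ ≤ t * (‖e₁‖ + ‖e₂‖) := by gcongr; exact norm_add_le _ _
      _ = A := by rw [ht, div_mul_cancel₀ _ hne]
  have h0 : ‖w₀‖ ^ 2 / A ^ 2 - 1 ≤ 0 := by
    rw [sub_nonpos, div_le_one (by positivity)]
    exact pow_le_pow_left₀ (norm_nonneg _) hw₀A 2
  have hgw₀ : g w₀ = t ^ 2 * (‖e₁‖ ^ 2 * ‖e₂‖ ^ 2) := by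
    rw [hg]
    show inner ℝ e₁ w₀ * inner ℝ e₂ w₀ * (1 - Real.smoothTransition (‖w₀‖ ^ 2 / A ^ 2 - 1)) = _
    rw [Real.smoothTransition.zero_of_nonpos h0, hw₀]
    simp only [inner_smul_right, inner_add_right, real_inner_self_eq_norm_sq, he, he']
    ring
  rw [integral_stdGaussian_eq_integral_mul_globalMaxwellian]
  have hc : Continuous fun v : V3 => globalMaxwellian v * g v ^ 2 :=
    continuous_globalMaxwellian.mul (hgc.pow 2)
  have hs : HasCompactSupport fun v : V3 => globalMaxwellian v * g v ^ 2 :=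
    hgs.mono fun v hv => by
      simp only [Function.mem_support, ne_eq] at hv ⊢
      intro hv0
      exact hv (by rw [hv0]; ring)
  have hnn : 0 ≤ fun v : V3 => globalMaxwellian v * g v ^ 2 := fun v =>
    mul_nonneg (globalMaxwellian_pos v).le (sq_nonneg _)
  have hx : (fun v : V3 => globalMaxwellian v * g v ^ 2) w₀ ≠ 0 := by
    show globalMaxwellian w₀ * g w₀ ^ 2 ≠ 0
    rw [hgw₀]
    exact mul_ne_zero (globalMaxwellian_pos w₀).ne' (by positivity)
  exact hc.integral_pos_of_hasCompactSupport_nonneg_nonzero hs hnn hx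

/-! ## The conditional reduction of S3 to `BoltzmannGreenKubo` -/

/-- **S3 ⇐ 13985.** Assuming the route's typed crux `BoltzmannGreenKubo` (stmt-AtomisticToContinuum-13985),
the registered stub `stub_diluteCornerDecay` of line `cutoff-compactness-net` holds, with its signature
verbatim: for every cutoff stress `g = g_{e₁,e₂,A}` (`e₁ ⊥ e₂`, `A > 0`) and every fraction `r > 0` there
are a kinetic window `s` (13985's `h = s/(σ²√θ)·(N+1)^(-1/3)`) and `σ₀` such that for `σ < σ₀`, uniformly in
`N ≥ N₀` and in the flow, the unmodulated window second moment is `≤ r·(N+1)‖g‖²_γ`. -/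
theorem diluteCornerDecay_of_boltzmannGreenKubo (hBGK : BoltzmannGreenKubo) :
    ∀ (a θ : ℝ) (u₀ : V3), 0 < a → 0 < θ →
    ∀ (e₁ e₂ : V3), inner ℝ e₁ e₂ = 0 → ∀ A : ℝ, 0 < A →
    ∀ g : V3 → ℝ, (g = fun w => inner ℝ e₁ w * inner ℝ e₂ w * (1 - Real.smoothTransition (‖w‖ ^ 2 / A ^ 2 - 1))) →
    ∀ r : ℝ, 0 < r → ∃ s : ℝ, 0 < s ∧ ∃ σ₀ : ℝ, 0 < σ₀ ∧ ∀ σ : ℝ, 0 < σ → σ < σ₀ →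
      ∃ N₀ : ℕ, ∀ N : ℕ, N₀ ≤ N → ∀ Φ : HardSphereFlow (Torus.geometry (Fin 3)) (hsDiameter σ N) (N + 1),
        ∫⁻ z, ENNReal.ofReal (((s / (σ ^ 2 * Real.sqrt θ) * ((N + 1 : ℕ) : ℝ) ^ (-(1 / 3 : ℝ)))⁻¹ *
            ∫ r' in (0 : ℝ)..(s / (σ ^ 2 * Real.sqrt θ) * ((N + 1 : ℕ) : ℝ) ^ (-(1 / 3 : ℝ))),
              ∑ i, g ((Real.sqrt θ)⁻¹ • ((Φ.flow r' z i).2 - u₀))) ^ 2)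
          ∂(localGibbsLaw σ (fun _ => a) (fun _ => u₀) (fun _ => θ) N Φ) ≤
        ENNReal.ofReal (r * (((N : ℝ)) + 1) * ∫ v, g v ^ 2 ∂stdGaussian V3) := by
  intro a θ u₀ ha hθ e₁ e₂ he A hA g hg r hr
  -- the degenerate directions: `g ≡ 0`
  by_cases hdeg : e₁ = 0 ∨ e₂ = 0
  · have hg0 : ∀ w, g w = 0 := fun w => by rcases hdeg with h | h <;> simp [hg, h]
    refine ⟨1, one_pos, 1, one_pos, fun σ _ _ => ⟨0, fun N _ Φ => ?_⟩⟩
    simp [hg0]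
  push Not at hdeg
  -- the observable: continuity, boundedness, orthogonality, non-degeneracy
  have hgc : Continuous g := by rw [hg]; exact continuous_cutoff e₁ e₂ A
  have hKv : ∀ v, |g v| ≤ 2 * A ^ 2 * (‖e₁‖ * ‖e₂‖) := fun v => by rw [hg]; exact abs_cutoff_le e₁ e₂ hA v
  have hn : 0 < ∫ v, g v ^ 2 ∂stdGaussian V3 := integral_cutoff_sq_pos hdeg.1 hdeg.2 he hA hg
  set n : ℝ := ∫ v, g v ^ 2 ∂stdGaussian V3 with hndef
  set K : ℝ := 2 * A ^ 2 * (‖e₁‖ * ‖e₂‖) with hKdef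
  set D : ℝ := Literature.Analysis.UnboundedOperators.dirichletFormInv
    (Literature.Analysis.UnboundedOperators.hardSphereLinearizedOp (E := V3)) g with hDdef
  -- 13985 at `φ ≡ 1`, `η = 1`
  obtain ⟨s₀, -, H⟩ := hBGK a θ u₀ ha hθ (fun _ => (1 : ℝ)) g continuous_const hgc
    (fun _ => by norm_num) ⟨K, hKv⟩ (cutoff_orth he hA hg) 1 one_pos
  set s : ℝ := max s₀ (max 1 ((2 * D + 1) / (r * n))) with hsdef
  have hs1 : 1 ≤ s := (le_max_left _ _).trans (le_max_right _ _)
  have hspos : 0 < s := one_pos.trans_le hs1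
  have hsD : (2 * D + 1) / (r * n) ≤ s := (le_max_right _ _).trans (le_max_right _ _)
  obtain ⟨σ₀, hσ₀, H'⟩ := H s (le_max_left _ _)
  refine ⟨s, hspos, σ₀, hσ₀, fun σ hσ hσlt => ?_⟩
  obtain ⟨hprob, N₀, H''⟩ := H' σ hσ hσlt
  refine ⟨N₀, fun N hN Φ => ?_⟩
  have key := H'' N hN Φ
  haveI := hprob N Φ
  dsimp only at key
  have hT3 : ∫ _x : T3, (1 : ℝ) ^ 2 = 1 := by simp
  rw [hT3, mul_one] at key
  simp only [one_mul] at key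
  set μ := localGibbsLaw σ (fun _ => a) (fun _ => u₀) (fun _ => θ) N Φ with hμ
  set h : ℝ := s / (σ ^ 2 * Real.sqrt θ) * ((N + 1 : ℕ) : ℝ) ^ (-(1 / 3 : ℝ)) with hh
  have hhpos : 0 < h := by positivity
  set L := ∫⁻ z, ENNReal.ofReal ((h⁻¹ * ∫ r' in (0 : ℝ)..h,
    ∑ i, g ((Real.sqrt θ)⁻¹ • ((Φ.flow r' z i).2 - u₀))) ^ 2) ∂μ with hL
  -- the window average is bounded by `(N+1)K` at EVERY phase point, so `L < ∞`
  have hWbd : ∀ z, |h⁻¹ * ∫ r' in (0 : ℝ)..h, ∑ i, g ((Real.sqrt θ)⁻¹ • ((Φ.flow r' z i).2 - u₀))| ≤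
      ((N + 1 : ℕ) : ℝ) * K := by
    intro z
    rw [abs_mul, abs_inv, abs_of_pos hhpos]
    have hI := intervalIntegral.norm_integral_le_of_norm_le_const (a := (0 : ℝ)) (b := h)
      (C := ((N + 1 : ℕ) : ℝ) * K) (f := fun r' => ∑ i, g ((Real.sqrt θ)⁻¹ • ((Φ.flow r' z i).2 - u₀)))
      (fun r' _ => by
        rw [Real.norm_eq_abs]
        calc |∑ i, g ((Real.sqrt θ)⁻¹ • ((Φ.flow r' z i).2 - u₀))|
            ≤ ∑ i, |g ((Real.sqrt θ)⁻¹ • ((Φ.flow r' z i).2 - u₀))| := Finset.abs_sum_le_sum_abs _ _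
          _ ≤ ∑ _i : Fin (N + 1), K := Finset.sum_le_sum fun i _ => hKv _
          _ = ((N + 1 : ℕ) : ℝ) * K := by simp)
    rw [Real.norm_eq_abs, sub_zero, abs_of_pos hhpos] at hI
    calc h⁻¹ * |∫ r' in (0 : ℝ)..h, ∑ i, g ((Real.sqrt θ)⁻¹ • ((Φ.flow r' z i).2 - u₀))|
        ≤ h⁻¹ * (((N + 1 : ℕ) : ℝ) * K * h) := by gcongr
      _ = ((N + 1 : ℕ) : ℝ) * K := by field_simp
  have hLle : L ≤ ∫⁻ _z, ENNReal.ofReal ((((N + 1 : ℕ) : ℝ) * K) ^ 2) ∂μ :=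
    lintegral_mono fun z => ENNReal.ofReal_le_ofReal
      (sq_le_sq' (abs_le.1 (hWbd z)).1 (abs_le.1 (hWbd z)).2)
  have hLfin : L ≠ ⊤ := by
    refine (hLle.trans_lt ?_).ne
    rw [lintegral_const, measure_univ, mul_one]
    exact ENNReal.ofReal_lt_top
  -- the real-number bookkeeping
  have hNpos : (0 : ℝ) < (N : ℝ) + 1 := by positivity
  have h1 : s * L.toReal ≤ (2 * D + 1) * ((N : ℝ) + 1) := by
    have h2 : s * (L.toReal / ((N : ℝ) + 1)) ≤ 2 * D + 1 := by linarith [(abs_le.1 key).2]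
    rwa [← mul_div_assoc, div_le_iff₀ hNpos] at h2
  have ht : L.toReal ≤ r * ((N : ℝ) + 1) * n := by
    have hrn : 0 < r * n := mul_pos hr hn
    have hRHS : 0 ≤ r * ((N : ℝ) + 1) * n := by positivity
    have hL0 : 0 ≤ L.toReal := ENNReal.toReal_nonneg
    by_cases hD : 2 * D + 1 ≤ 0
    · have hsl : s * L.toReal ≤ 0 := h1.trans (by nlinarith)
      have hle0 : L.toReal ≤ 0 := by
        by_contra hcon
        push Not at hcon
        linarith [mul_pos hspos hcon]
      linarith
    · push Not at hD
      rw [div_le_iff₀ hrn] at hsD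
      have h3 : s * L.toReal ≤ s * (r * ((N : ℝ) + 1) * n) := by nlinarith
      exact le_of_mul_le_mul_left h3 hspos
  calc L = ENNReal.ofReal L.toReal := (ENNReal.ofReal_toReal hLfin).symm
    _ ≤ ENNReal.ofReal (r * ((N : ℝ) + 1) * n) := ENNReal.ofReal_le_ofReal ht

/-- **Registered form of the conditional reduction** (sub-stub `stub_diluteCornerDecay_of_BGK` of crux
stmt-AtomisticToContinuum-14136, line `cutoff-compactness-net`): `BoltzmannGreenKubo → stub_diluteCornerDecay`,
all binders explicit, the hypothesis spelled as the fully-qualified route decl (retired by route-repair rev 11 and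
re-bound in this file to the verbatim statement of stmt-13985 — module docstring, § Dependency drift). -/
theorem stub_diluteCornerDecay_of_BGK :
    Summit.AtomisticToContinuum.HydrodynamicLimit.Theses.AntiMazurCoboundaries.BoltzmannGreenKubo →
    ∀ (a θ : ℝ) (u₀ : V3), 0 < a → 0 < θ →
    ∀ (e₁ e₂ : V3), inner ℝ e₁ e₂ = 0 → ∀ A : ℝ, 0 < A →
    ∀ g : V3 → ℝ, (g = fun w => inner ℝ e₁ w * inner ℝ e₂ w * (1 - Real.smoothTransition (‖w‖ ^ 2 / A ^ 2 - 1))) →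
    ∀ r : ℝ, 0 < r → ∃ s : ℝ, 0 < s ∧ ∃ σ₀ : ℝ, 0 < σ₀ ∧ ∀ σ : ℝ, 0 < σ → σ < σ₀ →
      ∃ N₀ : ℕ, ∀ N : ℕ, N₀ ≤ N → ∀ Φ : HardSphereFlow (Torus.geometry (Fin 3)) (hsDiameter σ N) (N + 1),
        ∫⁻ z, ENNReal.ofReal (((s / (σ ^ 2 * Real.sqrt θ) * ((N + 1 : ℕ) : ℝ) ^ (-(1 / 3 : ℝ)))⁻¹ *
            ∫ r' in (0 : ℝ)..(s / (σ ^ 2 * Real.sqrt θ) * ((N + 1 : ℕ) : ℝ) ^ (-(1 / 3 : ℝ))),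
              ∑ i, g ((Real.sqrt θ)⁻¹ • ((Φ.flow r' z i).2 - u₀))) ^ 2)
          ∂(localGibbsLaw σ (fun _ => a) (fun _ => u₀) (fun _ => θ) N Φ) ≤
        ENNReal.ofReal (r * (((N : ℝ)) + 1) * ∫ v, g v ^ 2 ∂stdGaussian V3) :=
  fun hBGK => diluteCornerDecay_of_boltzmannGreenKubo hBGK

end ShearStressHalfDrudeDiluteCorner

end Summit.AtomisticToContinuum.HydrodynamicLimit.Theorems
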